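import Literature.AlgebraicGeometry.Motives.HodgeStructureLefschetzGroupTransport
import Literature.AlgebraicGeometry.Motives.HodgeStructureEndAlgCentralizerUnitaryGeneration
import HarnessLib

/-!
# Milne's `C(A) ⊗ K` with its involution, and the sentence "the `k`-algebra `C(A)` is generated by the `γ ∈ S(A)(k)`",
# depend only on the isomorphism class: transport along `e : e^* H ⥲ H` on `K`-points
# (Milne 1999 §1 p. 643 L7–L11, p. 644 L16–L21, Remark 1.6; §3 p. 653 L42–L46)

[topic AlgebraicGeometry/Motives]

Layer `Literature/AlgebraicGeometry/Motives`, lane `lit-hodgefound` (Track 2 foundations library; seat `lit-hodgefound-p34`,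
generation 24, self-proposed row g24-#3), namespace `Literature.AlgebraicGeometry.Motives.HodgeStructure`. The `K`-ALGEBRA
companion of the seat's g20-#4 `Motives/HodgeStructureLefschetzGroupTransport`, which transports the `ℚ`-algebra `C(H)` with `†`
(`centralizerEndAlgComapEquivAlgEquiv`) and the GROUPS `S(H)(K)`, `G(H)(K)` along the tree's transport of structure
`HodgeStructure.comapEquiv H e = e^* H`, `Polarization.comapEquiv Q e = e^* Q = Q(e ·, e ·)` for a `ℚ`-linear equivalence
`e : V ⥲ W` (Milne's `V(α) : V(A) ⥲ V(B)` of an isogeny `α`), but not the `K`-algebra `C(H)(K) = Z_{End_K(K ⊗ V)}(E_φ ⊗ K)` of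
the seat's later `K`-points files. Here: `C(e^* H)(K) ≃ₐ[K] C(H)(K)` by conjugation with `1 ⊗ e` (Mathlib's
`LinearEquiv.conjAlgEquiv`), compatible with the involutions `†'` (of `(e^* Q)_K`) and `†` (of `Q_K`), matching the unitary
elements, and consequently the transport of the two readings of "the `k`-algebra `C(A)` is generated by the `γ ∈ S(A)(k)`"
(`(C, †)` generated by its unitary elements; `K[S(H)(K)] = C(H)(K)`) — so that the seat's results for the simple types (g23-#5,
g24-#1) and for `Hom`-orthogonal sums and powers (g24-#2, on the `pi`-carrier) apply to every polarized Hodge structure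
ISOMORPHIC to such a sum. One DEFINITION WITH BODY (`centralizerEndAlgBaseChangeComapEquivAlgEquiv`) + THEOREMS; no named fact,
no `sorry` (D-0026, net debt `0`).

## The source, verbatim

J. S. Milne, *Lefschetz classes on abelian varieties*, Duke Math. J. **96** (1999) 639–675 [Milne1999LefschetzClasses] (held
text `paper:doi-10-1215-s0012-7094-99-09620-5`; p0005 = p. 643, p0006 = p. 644, p0015 = p. 653):
* (§1 p. 643 L5–L11) "Then `C(A)` is a `k`-algebra stable under the involution `†` defined by an ample divisor `D`, and the
  restriction of `†` to `C(A)` is independent of the choice of `D`. An isogeny `α : A → B` defines an isomorphism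
  `γ ↦ V(α) ∘ γ ∘ V(α)⁻¹ : C(A) → C(B)` of `k`-algebras with involution, which is independent of the choice of `α`. Therefore
  `C(A)`, as a `k`-algebra with involution, depends only on the isogeny class of `A` (up to a canonical isomorphism)."
* (§1 p. 644 L18–L21) "`S(A)(R) = {γ ∈ C(A) ⊗_k R | γ†γ = 1}`. […] Clearly `S(A)` depends only on the isogeny class of `A` (up
  to a unique isomorphism)."; (p. 644 L30–L34) "**Remark 1.6.** If `X ↦ H*(X)` is a Weil cohomology theory with coefficient
  field `k`, and `k′` is a field containing `k`, then `X ↦ H*(X) ⊗_k k′` is a Weil cohomology theory with coefficient field `k′`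
  […] `C′(A) ≅ C(A) ⊗_k k′`, `S′(A) ≅ S(A)_{/k′}`."
* (§3 p. 653 L42–L46) "The next lemma shows that the `k`-algebra `C(A)` is generated by the `γ ∈ S(A)(k)` […] **Lemma 3.5.**
  Any semisimple algebra with involution `(R, †)` of finite dimension over an algebraically closed field `k` is generated (as a
  `k`-algebra) by the subset `U` of elements `u` satisfying `u†u = 1`."

## What is PROVED (`E = 1 ⊗ e = e.baseChange ℚ K V W : K ⊗ V ⥲ K ⊗ W`)

* §1 `conjAlgEquiv_baseChange_baseChange` (`E a_K E⁻¹ = (e a e⁻¹)_K`), `conjAlgEquiv_baseChange_baseChange_symm_comp_comp`,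
  `image_conjAlgEquiv_baseChange_endAlg_comapEquiv` (the generators `{a_K}` correspond), **`mem_centralizer_endAlg_comapEquiv_baseChange_iff`**
  (`c ∈ C(e^* H)(K) ↔ E c E⁻¹ ∈ C(H)(K)`), `map_conjAlgEquiv_centralizer_endAlg_comapEquiv_baseChange`, DEF
  **`centralizerEndAlgBaseChangeComapEquivAlgEquiv K H e : C(e^* H)(K) ≃ₐ[K] C(H)(K)`** ("`γ ↦ V(α) ∘ γ ∘ V(α)⁻¹`") with
  `coe_…` / `…_apply_apply`.
* §2 **`Polarization.conjAlgEquiv_adjointBaseChange_comapEquiv`** (`E c^{†'} E⁻¹ = (E c E⁻¹)^†`: "of `k`-algebras with involution"),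
  `Polarization.centralizerEndAlgBaseChangeComapEquivAlgEquiv_centralizerAdjoint`,
  `Polarization.centralizerAdjoint_mul_self_eq_one_iff_comapEquiv` and `Polarization.image_…_setOf_unitary` (the unitary elements
  correspond — "`S(A)` depends only on the isogeny class").
* §3 **`Polarization.adjoin_setOf_centralizerAdjoint_mul_self_eq_one_eq_top_iff_comapEquiv`** (`(C(e^* H)(K), †')` is generated by
  its unitary elements iff `(C(H)(K), †)` is), `Polarization.image_conjAlgEquiv_coe_lefschetzGroupBaseChange_comapEquiv`
  (`E S(e^* H)(K) E⁻¹ = S(H)(K)` on underlying endomorphisms), **`Polarization.adjoin_coe_lefschetzGroupBaseChange_eq_centralizer_iff_comapEquiv`**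
  (`K[S(e^* H)(K)] = C(e^* H)(K)` iff `K[S(H)(K)] = C(H)(K)`).

NOT here (honest scope): "independent of the choice of `α`" for the `K`-algebra isomorphism (the seat's g20-#4 proves it for
`C(H)` and `S(H)(K)`; the same two-line argument applies but is not repeated); isogenies that are not isomorphisms of `ℚ`-Hodge
structures do not occur on the rational carrier (`V(α)` is an isomorphism). HC is NOT proved; nothing here claims a case of the
Hodge conjecture.

## References

* [Milne1999LefschetzClasses] J. S. Milne, *Lefschetz classes on abelian varieties*, Duke Math. J. 96 (1999) 639–675 — §1 p. 643
  L5–L11, p. 644 L16–L21 and Remark 1.6 (L30–L34); §3 p. 653 L42–L46.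
-/

noncomputable section

open scoped TensorProduct

universe uK u

namespace Literature.AlgebraicGeometry.Motives

namespace HodgeStructure

variable (K : Type uK) [Field K] [Algebra ℚ K] {V W : Type u} [AddCommGroup V] [Module ℚ V] [AddCommGroup W]
  [Module ℚ W] {n : ℤ} (H : HodgeStructure W n) (e : V ≃ₗ[ℚ] W)

/-! ## §1 `C(e^* H)(K) → C(H)(K)`, `c ↦ (1 ⊗ e) c (1 ⊗ e)⁻¹`: "an isomorphism `γ ↦ V(α) ∘ γ ∘ V(α)⁻¹ : C(A) → C(B)`" on `K`-points -/

section Algebra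

/-- `(1⊗e) a_K (1⊗e)⁻¹ = (e a e⁻¹)_K`: conjugation by the base change of `e` carries base changes to base changes.
[cite: Milne1999LefschetzClasses, §1 Remark 1.6 (p. 644)] -/
theorem conjAlgEquiv_baseChange_baseChange (a : Module.End ℚ V) :
    (e.baseChange ℚ K V W).conjAlgEquiv K (a.baseChange K) = (e.toLinearMap ∘ₗ a ∘ₗ e.symm.toLinearMap).baseChange K :=
  LinearMap.ext fun y ↦ by
    rw [LinearEquiv.conjAlgEquiv_apply, LinearMap.comp_apply, LinearMap.comp_apply, LinearEquiv.coe_coe,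
      LinearEquiv.coe_coe, baseChange_comp_comp_symm_apply]

/-- `(1⊗e) (e⁻¹ b e)_K (1⊗e)⁻¹ = b_K`. [cite: Milne1999LefschetzClasses, §1 Remark 1.6 (p. 644)] -/
theorem conjAlgEquiv_baseChange_baseChange_symm_comp_comp (b : Module.End ℚ W) :
    (e.baseChange ℚ K V W).conjAlgEquiv K ((e.symm.toLinearMap ∘ₗ b ∘ₗ e.toLinearMap).baseChange K) = b.baseChange K :=
  LinearMap.ext fun y ↦ by
    rw [LinearEquiv.conjAlgEquiv_apply, LinearMap.comp_apply, LinearMap.comp_apply, LinearEquiv.coe_coe,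
      LinearEquiv.coe_coe, baseChange_symm_comp_comp_apply, LinearEquiv.apply_symm_apply, LinearEquiv.apply_symm_apply]

/-- **The generators correspond**: `(1⊗e) {a_K | a ∈ E_φ(e^* H)} (1⊗e)⁻¹ = {b_K | b ∈ E_φ(H)}`.
[cite: Milne1999LefschetzClasses, §1 p. 643 L7–L11 and Remark 1.6] -/
theorem image_conjAlgEquiv_baseChange_endAlg_comapEquiv :
    (e.baseChange ℚ K V W).conjAlgEquiv K '' ((fun a : Module.End ℚ V ↦ a.baseChange K) ''
        ((H.comapEquiv e).endAlg : Set (Module.End ℚ V))) =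
      (fun b : Module.End ℚ W ↦ b.baseChange K) '' (H.endAlg : Set (Module.End ℚ W)) := by
  ext f
  constructor
  · rintro ⟨_, ⟨a, ha, rfl⟩, rfl⟩
    exact ⟨_, (mem_endAlg_comapEquiv_iff H e a).1 ha, (conjAlgEquiv_baseChange_baseChange K e a).symm⟩
  · rintro ⟨b, hb, rfl⟩
    exact ⟨_, ⟨_, (mem_endAlg_iff_symm_comp_comp_mem_endAlg_comapEquiv H e b).1 hb, rfl⟩,
      conjAlgEquiv_baseChange_baseChange_symm_comp_comp K e b⟩

/-- **`c ∈ C(e^* H)(K) ↔ (1⊗e) c (1⊗e)⁻¹ ∈ C(H)(K)`** ("An isogeny `α : A → B` defines an isomorphism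
`γ ↦ V(α) ∘ γ ∘ V(α)⁻¹ : C(A) → C(B)`", on `K`-points). [cite: Milne1999LefschetzClasses, §1 p. 643 L7–L11 and Remark 1.6 (p. 644, "C′(A) ≅ C(A) ⊗_k k′")] -/
theorem mem_centralizer_endAlg_comapEquiv_baseChange_iff (c : Module.End K (K ⊗[ℚ] V)) :
    c ∈ Subalgebra.centralizer K ((fun a : Module.End ℚ V ↦ a.baseChange K) ''
        ((H.comapEquiv e).endAlg : Set (Module.End ℚ V))) ↔
      (e.baseChange ℚ K V W).conjAlgEquiv K c ∈
        Subalgebra.centralizer K ((fun b : Module.End ℚ W ↦ b.baseChange K) '' (H.endAlg : Set (Module.End ℚ W))) := by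
  rw [Subalgebra.mem_centralizer_iff, Subalgebra.mem_centralizer_iff, ← image_conjAlgEquiv_baseChange_endAlg_comapEquiv K H e]
  constructor
  · rintro h _ ⟨g, hg, rfl⟩
    rw [← map_mul, ← map_mul, h g hg]
  · intro h g hg
    apply ((e.baseChange ℚ K V W).conjAlgEquiv K).injective
    rw [map_mul, map_mul]
    exact h _ ⟨g, hg, rfl⟩

/-- **`(1⊗e) C(e^* H)(K) (1⊗e)⁻¹ = C(H)(K)`** as `K`-subalgebras. [cite: Milne1999LefschetzClasses, §1 p. 643 L7–L11 and Remark 1.6] -/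
theorem map_conjAlgEquiv_centralizer_endAlg_comapEquiv_baseChange :
    (Subalgebra.centralizer K ((fun a : Module.End ℚ V ↦ a.baseChange K) ''
        ((H.comapEquiv e).endAlg : Set (Module.End ℚ V)))).map
      ((e.baseChange ℚ K V W).conjAlgEquiv K : Module.End K (K ⊗[ℚ] V) →ₐ[K] Module.End K (K ⊗[ℚ] W)) =
      Subalgebra.centralizer K ((fun b : Module.End ℚ W ↦ b.baseChange K) '' (H.endAlg : Set (Module.End ℚ W))) := by
  ext f
  rw [Subalgebra.mem_map]
  constructor
  · rintro ⟨c, hc, rfl⟩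
    exact (mem_centralizer_endAlg_comapEquiv_baseChange_iff K H e c).1 hc
  · intro hf
    refine ⟨((e.baseChange ℚ K V W).conjAlgEquiv K).symm f, ?_, AlgEquiv.apply_symm_apply _ f⟩
    rw [mem_centralizer_endAlg_comapEquiv_baseChange_iff, AlgEquiv.apply_symm_apply]
    exact hf

/-- **Milne's isomorphism `γ ↦ V(α) ∘ γ ∘ V(α)⁻¹ : C(A) → C(B)` on `K`-points: `C(e^* H)(K) ≃ₐ[K] C(H)(K)`,
`c ↦ (1⊗e) c (1⊗e)⁻¹`** for an isomorphism `e : e^* H ⥲ H` of `ℚ`-Hodge structures and every field `K ⊇ ℚ` (the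
`K`-points companion of the seat's `centralizerEndAlgComapEquivAlgEquiv`, `K = ℚ`). [cite: Milne1999LefschetzClasses, §1 p. 643 L7–L11 ("Therefore C(A), as a k-algebra with involution, depends only on the isogeny class of A") and Remark 1.6] -/
def centralizerEndAlgBaseChangeComapEquivAlgEquiv :
    Subalgebra.centralizer K ((fun a : Module.End ℚ V ↦ a.baseChange K) ''
        ((H.comapEquiv e).endAlg : Set (Module.End ℚ V))) ≃ₐ[K]
      Subalgebra.centralizer K ((fun b : Module.End ℚ W ↦ b.baseChange K) '' (H.endAlg : Set (Module.End ℚ W))) :=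
  (((e.baseChange ℚ K V W).conjAlgEquiv K).subalgebraMap _).trans
    (Subalgebra.equivOfEq _ _ (map_conjAlgEquiv_centralizer_endAlg_comapEquiv_baseChange K H e))

/-- `(equiv c : End) = (1⊗e) ∘ c ∘ (1⊗e)⁻¹`. [cite: Milne1999LefschetzClasses, §1 p. 643 L7–L8] -/
@[simp] theorem coe_centralizerEndAlgBaseChangeComapEquivAlgEquiv
    (c : Subalgebra.centralizer K ((fun a : Module.End ℚ V ↦ a.baseChange K) ''
      ((H.comapEquiv e).endAlg : Set (Module.End ℚ V)))) :
    ((centralizerEndAlgBaseChangeComapEquivAlgEquiv K H e c : Subalgebra.centralizer K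
        ((fun b : Module.End ℚ W ↦ b.baseChange K) '' (H.endAlg : Set (Module.End ℚ W)))) : Module.End K (K ⊗[ℚ] W)) =
      (e.baseChange ℚ K V W).toLinearMap ∘ₗ (c : Module.End K (K ⊗[ℚ] V)) ∘ₗ (e.baseChange ℚ K V W).symm.toLinearMap :=
  rfl

/-- `(equiv c) y = (1⊗e) (c ((1⊗e)⁻¹ y))`. [cite: Milne1999LefschetzClasses, §1 p. 643 L7–L8] -/
theorem centralizerEndAlgBaseChangeComapEquivAlgEquiv_apply_apply
    (c : Subalgebra.centralizer K ((fun a : Module.End ℚ V ↦ a.baseChange K) ''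
      ((H.comapEquiv e).endAlg : Set (Module.End ℚ V)))) (y : K ⊗[ℚ] W) :
    ((centralizerEndAlgBaseChangeComapEquivAlgEquiv K H e c : Subalgebra.centralizer K
        ((fun b : Module.End ℚ W ↦ b.baseChange K) '' (H.endAlg : Set (Module.End ℚ W)))) : Module.End K (K ⊗[ℚ] W)) y =
      e.baseChange ℚ K V W ((c : Module.End K (K ⊗[ℚ] V)) ((e.baseChange ℚ K V W).symm y)) :=
  rfl

end Algebra

/-! ## §2 "as a `k`-algebra with involution": `(1⊗e) c^{†'} (1⊗e)⁻¹ = ((1⊗e) c (1⊗e)⁻¹)^†` for the adjoints of `(e^* Q)_K` and `Q_K` -/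

section Involution

variable {H} [Module.Finite ℚ V] [Module.Finite ℚ W] (Q : Polarization H)

/-- **The involutions correspond**: for every `c ∈ End_K(K ⊗ V)`, `(1⊗e) c^{†'} (1⊗e)⁻¹ = ((1⊗e) c (1⊗e)⁻¹)^†`, where `†'`
is the adjoint for `(e^* Q)_K` and `†` the adjoint for `Q_K` (`(e^* Q)_K(x, y) = Q_K((1⊗e)x, (1⊗e)y)`).
[cite: Milne1999LefschetzClasses, §1 p. 643 L7–L9 ("an isomorphism … of k-algebras with involution") and Remark 1.6] -/
theorem Polarization.conjAlgEquiv_adjointBaseChange_comapEquiv (c : Module.End K (K ⊗[ℚ] V)) :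
    (e.baseChange ℚ K V W).conjAlgEquiv K ((Q.comapEquiv e).adjointBaseChange K c) =
      Q.adjointBaseChange K ((e.baseChange ℚ K V W).conjAlgEquiv K c) := by
  refine Q.eq_adjointBaseChange_of_isAdjointPair K ?_
  intro x y
  have h := (Q.comapEquiv e).baseChange_form_apply_adjointBaseChange K c ((e.baseChange ℚ K V W).symm x)
    ((e.baseChange ℚ K V W).symm y)
  rw [Polarization.comapEquiv_form_baseChange_apply, Polarization.comapEquiv_form_baseChange_apply,
    LinearEquiv.apply_symm_apply, LinearEquiv.apply_symm_apply] at h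
  simp only [LinearEquiv.conjAlgEquiv_apply, LinearMap.coe_comp, LinearEquiv.coe_coe, Function.comp_apply]
  exact h.symm

/-- **`C(e^* H)(K) ≃ₐ[K] C(H)(K)` is an isomorphism of algebras WITH INVOLUTION**: `equiv (c^{†'}) = (equiv c)^†` for the
involutions `Polarization.centralizerAdjoint` of `e^* Q` and `Q`. [cite: Milne1999LefschetzClasses, §1 p. 643 L7–L11] -/
theorem Polarization.centralizerEndAlgBaseChangeComapEquivAlgEquiv_centralizerAdjoint
    (c : Subalgebra.centralizer K ((fun a : Module.End ℚ V ↦ a.baseChange K) ''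
      ((H.comapEquiv e).endAlg : Set (Module.End ℚ V)))) :
    centralizerEndAlgBaseChangeComapEquivAlgEquiv K H e ((Q.comapEquiv e).centralizerAdjoint K c) =
      Q.centralizerAdjoint K (centralizerEndAlgBaseChangeComapEquivAlgEquiv K H e c) :=
  Subtype.ext (by
    rw [Polarization.coe_centralizerAdjoint, coe_centralizerEndAlgBaseChangeComapEquivAlgEquiv,
      coe_centralizerEndAlgBaseChangeComapEquivAlgEquiv, Polarization.coe_centralizerAdjoint,
      ← LinearEquiv.conjAlgEquiv_apply (R := K), ← LinearEquiv.conjAlgEquiv_apply (R := K),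
      Polarization.conjAlgEquiv_adjointBaseChange_comapEquiv])

/-- **Unitary elements correspond**: `c^{†'} c = 1` in `C(e^* H)(K)` iff `(equiv c)^† (equiv c) = 1` in `C(H)(K)`
("`S(A)(R) = {γ ∈ C(A) ⊗ R | γ†γ = 1}` … depends only on the isogeny class"). [cite: Milne1999LefschetzClasses, §1 p. 644 L16–L21] -/
theorem Polarization.centralizerAdjoint_mul_self_eq_one_iff_comapEquiv
    (c : Subalgebra.centralizer K ((fun a : Module.End ℚ V ↦ a.baseChange K) ''
      ((H.comapEquiv e).endAlg : Set (Module.End ℚ V)))) :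
    (Q.comapEquiv e).centralizerAdjoint K c * c = 1 ↔
      Q.centralizerAdjoint K (centralizerEndAlgBaseChangeComapEquivAlgEquiv K H e c) *
        centralizerEndAlgBaseChangeComapEquivAlgEquiv K H e c = 1 := by
  rw [← (centralizerEndAlgBaseChangeComapEquivAlgEquiv K H e).injective.eq_iff, map_mul, map_one,
    Polarization.centralizerEndAlgBaseChangeComapEquivAlgEquiv_centralizerAdjoint]

/-- **The unitary sets correspond under the isomorphism.** [cite: Milne1999LefschetzClasses, §1 p. 644 L16–L21] -/
theorem Polarization.image_centralizerEndAlgBaseChangeComapEquivAlgEquiv_setOf_unitary :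
    centralizerEndAlgBaseChangeComapEquivAlgEquiv K H e ''
        {c | (Q.comapEquiv e).centralizerAdjoint K c * c = 1} = {c | Q.centralizerAdjoint K c * c = 1} := by
  ext f
  constructor
  · rintro ⟨c, hc, rfl⟩
    exact (Q.centralizerAdjoint_mul_self_eq_one_iff_comapEquiv K e c).1 hc
  · intro hf
    refine ⟨(centralizerEndAlgBaseChangeComapEquivAlgEquiv K H e).symm f, ?_, AlgEquiv.apply_symm_apply _ f⟩
    rw [Set.mem_setOf_eq, Q.centralizerAdjoint_mul_self_eq_one_iff_comapEquiv K e, AlgEquiv.apply_symm_apply]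
    exact hf

/-! ## §3 "The `k`-algebra `C(A)` is generated by the `γ ∈ S(A)(k)`" depends only on the isomorphism class -/

/-- **Lemma 3.5's conclusion transports**: `(C(e^* H)(K), †')` is generated by its unitary elements iff `(C(H)(K), †)` is.
[cite: Milne1999LefschetzClasses, §3 p. 653 L42–L46 with §1 p. 643 L7–L11] -/
theorem Polarization.adjoin_setOf_centralizerAdjoint_mul_self_eq_one_eq_top_iff_comapEquiv :
    Algebra.adjoin K {c : Subalgebra.centralizer K ((fun a : Module.End ℚ V ↦ a.baseChange K) ''
        ((H.comapEquiv e).endAlg : Set (Module.End ℚ V))) | (Q.comapEquiv e).centralizerAdjoint K c * c = 1} = ⊤ ↔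
      Algebra.adjoin K {c : Subalgebra.centralizer K ((fun b : Module.End ℚ W ↦ b.baseChange K) ''
        (H.endAlg : Set (Module.End ℚ W))) | Q.centralizerAdjoint K c * c = 1} = ⊤ := by
  set Ψ := centralizerEndAlgBaseChangeComapEquivAlgEquiv K H e with hΨ
  have hmap : (Algebra.adjoin K {c | (Q.comapEquiv e).centralizerAdjoint K c * c = 1}).map Ψ.toAlgHom =
      Algebra.adjoin K {c | Q.centralizerAdjoint K c * c = 1} := by
    rw [AlgHom.map_adjoin]
    exact congr_arg _ (Q.image_centralizerEndAlgBaseChangeComapEquivAlgEquiv_setOf_unitary K e)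
  constructor
  · intro h
    rw [← hmap, h, Algebra.map_top]
    exact (AlgHom.range_eq_top _).2 Ψ.surjective
  · intro h
    apply Subalgebra.map_injective (f := Ψ.toAlgHom) Ψ.injective
    rw [hmap, h, Algebra.map_top]
    exact ((AlgHom.range_eq_top _).2 Ψ.surjective).symm

omit [Module.Finite ℚ V] [Module.Finite ℚ W] in
/-- The underlying endomorphisms of `S(e^* H)(K)` and of `S(H)(K)` correspond under `c ↦ (1⊗e) c (1⊗e)⁻¹`
(the seat's `Polarization.mem_lefschetzGroupBaseChange_comapEquiv_iff`, read on `End_K`). [cite: Milne1999LefschetzClasses, §1 p. 644 L16–L21] -/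
theorem Polarization.image_conjAlgEquiv_coe_lefschetzGroupBaseChange_comapEquiv :
    (e.baseChange ℚ K V W).conjAlgEquiv K ''
        ((fun γ : (K ⊗[ℚ] V) ≃ₗ[K] (K ⊗[ℚ] V) ↦ (γ : Module.End K (K ⊗[ℚ] V))) ''
          ((Q.comapEquiv e).lefschetzGroupBaseChange K : Set _)) =
      (fun γ : (K ⊗[ℚ] W) ≃ₗ[K] (K ⊗[ℚ] W) ↦ (γ : Module.End K (K ⊗[ℚ] W))) '' (Q.lefschetzGroupBaseChange K : Set _) := by
  ext f
  constructor
  · rintro ⟨_, ⟨γ, hγ, rfl⟩, rfl⟩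
    refine ⟨_, (Q.mem_lefschetzGroupBaseChange_comapEquiv_iff K e γ).1 hγ, LinearMap.ext fun y ↦ ?_⟩
    simp only [LinearEquiv.coe_coe, LinearEquiv.trans_apply, LinearEquiv.conjAlgEquiv_apply, LinearMap.coe_comp,
      Function.comp_apply]
  · rintro ⟨Γ, hΓ, rfl⟩
    refine ⟨_, ⟨glConjHom (e.baseChange ℚ K V W) Γ,
      (Q.glConjHom_mem_lefschetzGroupBaseChange_comapEquiv_iff K e Γ).2 hΓ, rfl⟩, LinearMap.ext fun y ↦ ?_⟩
    simp only [LinearEquiv.coe_coe, LinearEquiv.conjAlgEquiv_apply, LinearMap.coe_comp, Function.comp_apply,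
      glConjHom_apply, LinearEquiv.apply_symm_apply]

omit [Module.Finite ℚ V] [Module.Finite ℚ W] in
/-- **"The `k`-algebra `C(A)` is generated by the `γ ∈ S(A)(k)`" depends only on the isomorphism class of the polarized Hodge
structure**: `K[S(e^* H)(K)] = C(e^* H)(K)` iff `K[S(H)(K)] = C(H)(K)` (conjugation by `1⊗e` carries `S` to `S` and `C` to `C`).
With the seat's files for the simple types and for `Hom`-orthogonal sums / powers this removes the `pi`-carrier from the
hypotheses: the sentence holds for every polarized `H` ISOMORPHIC to such a sum. [cite: Milne1999LefschetzClasses, §3 p. 653 L42–L46 with §1 p. 643 L7–L11 and p. 644 L16–L21] -/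
theorem Polarization.adjoin_coe_lefschetzGroupBaseChange_eq_centralizer_iff_comapEquiv :
    Algebra.adjoin K ((fun γ : (K ⊗[ℚ] V) ≃ₗ[K] (K ⊗[ℚ] V) ↦ (γ : Module.End K (K ⊗[ℚ] V))) ''
          ((Q.comapEquiv e).lefschetzGroupBaseChange K : Set _)) =
        Subalgebra.centralizer K ((fun a : Module.End ℚ V ↦ a.baseChange K) ''
          ((H.comapEquiv e).endAlg : Set (Module.End ℚ V))) ↔
      Algebra.adjoin K ((fun γ : (K ⊗[ℚ] W) ≃ₗ[K] (K ⊗[ℚ] W) ↦ (γ : Module.End K (K ⊗[ℚ] W))) ''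
          (Q.lefschetzGroupBaseChange K : Set _)) =
        Subalgebra.centralizer K ((fun b : Module.End ℚ W ↦ b.baseChange K) '' (H.endAlg : Set (Module.End ℚ W))) := by
  set Φ : Module.End K (K ⊗[ℚ] V) →ₐ[K] Module.End K (K ⊗[ℚ] W) := ((e.baseChange ℚ K V W).conjAlgEquiv K).toAlgHom
    with hΦ
  have hΦinj : Function.Injective Φ := ((e.baseChange ℚ K V W).conjAlgEquiv K).injective
  have hS : (Algebra.adjoin K ((fun γ : (K ⊗[ℚ] V) ≃ₗ[K] (K ⊗[ℚ] V) ↦ (γ : Module.End K (K ⊗[ℚ] V))) ''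
      ((Q.comapEquiv e).lefschetzGroupBaseChange K : Set _))).map Φ =
      Algebra.adjoin K ((fun γ : (K ⊗[ℚ] W) ≃ₗ[K] (K ⊗[ℚ] W) ↦ (γ : Module.End K (K ⊗[ℚ] W))) ''
        (Q.lefschetzGroupBaseChange K : Set _)) := by
    rw [AlgHom.map_adjoin]
    exact congr_arg _ (Q.image_conjAlgEquiv_coe_lefschetzGroupBaseChange_comapEquiv K e)
  have hC := map_conjAlgEquiv_centralizer_endAlg_comapEquiv_baseChange K H e
  constructor
  · intro h
    rw [← hS, h, ← hC]
  · intro h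
    apply Subalgebra.map_injective (f := Φ) hΦinj
    rw [hS, h, ← hC]

end Involution

end HodgeStructure

end Literature.AlgebraicGeometry.Motives

end
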